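import Literature.Computability.Cryptography.LiuPassCondEPPRG
import Literature.Computability.Complexity.SamplingChernoff
import HarnessLib

/-!
# Flattening Shannon entropy by independent repetition (Hoeffding on sample entropies)

Companion of `LiuPassCondEPPRG.lean` (`fiber`, `mapEntropy S f` = Shannon entropy of `f(U_S)` in
the "expected surprise" form) and `Complexity/SamplingChernoff.lean` (Hoeffding's inequality in
counting form). The printed lemma:

> **Haitner–Reingold–Vadhan 2013, Lemma 2.1 (1)** ("Flattening Shannon entropy. It is well-known
> that the Shannon entropy of a random variable can be converted to min-entropy (up to small
> statistical distance) by taking independent copies of this variable.") Let `X` be a random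
> variable taking values in a universe `U`, let `t ∈ ℕ`, and let `ε > 0`. Then with probability at
> least `1 − ε − 2^{−Ω(t)}` over `x ← Xᵗ`, `|H_{Xᵗ}(x) − t · H(X)| ≤ O(√(t · log(1/ε)) · log(|U| · t))`.

with the printed proof: `H_{Xᵗ}(x) = Σᵢ H_X(xᵢ)` is a sum of `t` independent sample entropies of
expectation `H(X)`, so Chernoff–Hoeffding bounds apply (the paper needs a tail-truncation because
`H_X` is unbounded in general). Here `H_X(a) = log₂ (1 / Pr[X = a])` is the sample entropy
(surprise) and `H(X) = E[H_X]`, `H_∞(X) = min H_X` (HRV13, §2.2).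

## What is proved (explicit constants; sources generated by finitely many coins)

For a source `X = x(U_Ω)` — the image of the uniform distribution on a finite nonempty type `Ω` of
coins under `x : Ω → U`, which is the shape of every distribution in the applications (`f(U_n)`,
`G(U_n)`, …) — the sample entropy of the outcome of the coins `w` is
`H_X(x w) = log₂ (|Ω| / |x⁻¹(x w)|) ∈ [0, log₂ |Ω|]` (`logb_card_div_card_fiber_nonneg/_le` of
`LiuPassCondEPPRG.lean`) and `H(X) = mapEntropy univ x`. For the `t`-fold repetition
`xᵗ : Ωᵗ → Uᵗ`, `w ↦ (x (w i))ᵢ`: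

* `card_fiber_tuple`, `sampleEntropy_tuple` — `|(xᵗ)⁻¹(xᵗ w)| = ∏ᵢ |x⁻¹(x wᵢ)|`, hence
  **`H_{Xᵗ}(xᵗ w) = Σᵢ H_X(x wᵢ)`**; `mapEntropy_tuple` — **`H(Xᵗ) = t · H(X)`**;
* `card_sampleEntropy_tuple_ge_le_exp` / `…_le_le_exp` — **Hoeffding tails with explicit constants**:
  for `t ≥ 1`, `η ≥ 0`, `|Ω| ≥ 2`, the coin tuples `w ∈ Ωᵗ` with
  `Σᵢ H_X(x wᵢ) ≥ t·H(X) + tη·log₂|Ω|` (resp. `≤ t·H(X) − tη·log₂|Ω|`) number at most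
  `exp(−2tη²) · |Ω|ᵗ` each (since `H_X/log₂|Ω|` is `[0,1]`-valued, plain Hoeffding applies and no
  truncation is needed; this is Lemma 2.1 (1) with deviation `η t log₂|Ω|` at confidence
  `2 exp(−2tη²)`, i.e. `O(√(t log(1/ε)) · log₂|Ω|)` at confidence `ε`, the coin-space size `|Ω|`
  replacing the paper's `|U| · t`);
* the two flattening consequences used by pseudorandom-generator constructions:
  `card_heavy_tuple_le_exp` — **smooth min-entropy**: all but an `exp(−2tη²)` fraction of `Ωᵗ`
  lies in fibres of `xᵗ` of size `< 2^{−(tH(X) − tη log₂|Ω|)} · |Ω|ᵗ` (i.e. `Xᵗ` is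
  `exp(−2tη²)`-close to min-entropy `≥ t·H(X) − tη·log₂|Ω|`), and
  `card_image_light_tuple_le` with `card_light_compl_le_exp` — **smooth max-entropy**: outside an
  `exp(−2tη²)` fraction of `Ωᵗ`, `xᵗ` takes at most `2^{tH(X) + tη log₂|Ω|}` values.

Everything is proved (Mathlib, `LiuPassCondEPPRG.lean`, `SamplingChernoff.lean`); no new
definitions. This is the "Shannon entropy to min-entropy" step of every construction of
pseudorandom generators from one-way functions (Håstad–Impagliazzo–Levin–Luby 1999, §4 (product
distributions); Holenstein 2006; Haitner–Reingold–Vadhan 2013, Lemma 2.1 and §5.2).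

## References

* I. Haitner, O. Reingold, S. Vadhan, *Efficiency improvements in constructing pseudorandom
  generators from one-way functions*, SIAM J. Comput. 42(3) (2013) 1405–1430,
  doi:10.1137/100814421: §2.2 (sample entropy, Shannon and min-entropy), Lemma 2.1 (flattening
  Shannon entropy) and its proof.
* J. Håstad, R. Impagliazzo, L. A. Levin, M. Luby, *A pseudorandom generator from any one-way
  function*, SIAM J. Comput. 28 (1999) 1364–1396, §4 (Shannon-to-min-entropy via product
  distributions).
* W. Hoeffding, *Probability inequalities for sums of bounded random variables*, JASA 58 (1963),
  Thm. 1–2 (through `SamplingChernoff.lean`).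
* T. Cover, J. Thomas, *Elements of Information Theory*, 2nd ed., Wiley 2006, Thm. 2.6.6
  (independence ⇒ additivity of entropy), §3.1 (AEP).
-/

namespace Literature.Computability.Cryptography

open Finset Real

section Flattening

variable {Ω U : Type*} [Fintype Ω] [DecidableEq U]

/-! ### Fibres and sample entropies of independent repetitions -/

/-- **The fibre of the `t`-fold map is the product of the fibres**: the coin tuples `v` with
`x (v i) = x (w i)` for all `i` form `∏ᵢ x⁻¹(x (w i))`. [Cover–Thomas 2006, Thm. 2.6.6
(independent repetitions)] [folklore] -/
theorem fiber_tuple_eq_piFinset (x : Ω → U) {t : ℕ} (w : Fin t → Ω) :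
    fiber univ (fun v : Fin t → Ω => fun i => x (v i)) (fun i => x (w i)) =
      Fintype.piFinset fun i => fiber univ x (x (w i)) := by
  ext v
  simp only [mem_fiber, Finset.mem_univ, true_and, Fintype.mem_piFinset]
  exact ⟨fun h i => congrFun h i, fun h => funext h⟩

/-- `|(xᵗ)⁻¹(xᵗ w)| = ∏ᵢ |x⁻¹(x (w i))|` (`Pr[Xᵗ = xᵗ w] = ∏ᵢ Pr[X = x (w i)]`).
[Cover–Thomas 2006, Thm. 2.6.6] [folklore] -/
theorem card_fiber_tuple (x : Ω → U) {t : ℕ} (w : Fin t → Ω) :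
    (fiber univ (fun v : Fin t → Ω => fun i => x (v i)) (fun i => x (w i))).card =
      ∏ i, (fiber univ x (x (w i))).card := by
  rw [fiber_tuple_eq_piFinset, Fintype.card_piFinset]

/-- Fibres through a point are nonempty: `0 < |x⁻¹(x w)|`. [folklore] -/
theorem card_fiber_univ_pos (x : Ω → U) (w : Ω) : 0 < (fiber univ x (x w)).card :=
  card_fiber_pos x (Finset.mem_univ w)

/-- **Sample entropy is additive over independent repetitions**:
`H_{Xᵗ}(xᵗ w) = Σᵢ H_X(x (w i))`, i.e.
`log₂ (|Ωᵗ| / |(xᵗ)⁻¹(xᵗ w)|) = Σᵢ log₂ (|Ω| / |x⁻¹(x (w i))|)`. [Haitner–Reingold–Vadhan 2013,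
proof of Lemma 2.1 ("`H_{Xᵗ}(x) = Σᵢ H_X(xᵢ)`")] [cite: HaitnerReingoldVadhan2013, Lemma 2.1 (proof)] -/
theorem sampleEntropy_tuple (x : Ω → U) {t : ℕ} (w : Fin t → Ω) :
    Real.logb 2 ((Fintype.card (Fin t → Ω) : ℝ) /
        (fiber univ (fun v : Fin t → Ω => fun i => x (v i)) (fun i => x (w i))).card) =
      ∑ i, Real.logb 2 ((Fintype.card Ω : ℝ) / (fiber univ x (x (w i))).card) := by
  rw [card_fiber_tuple, Fintype.card_pi_const, Nat.cast_pow, Nat.cast_prod]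
  rw [show ((Fintype.card Ω : ℝ)) ^ t = ∏ _i : Fin t, (Fintype.card Ω : ℝ) by
    rw [Finset.prod_const, Finset.card_univ, Fintype.card_fin]]
  rw [← Finset.prod_div_distrib]
  refine Real.logb_prod _ _ fun i _ => ?_
  have h1 : (0 : ℝ) < Fintype.card Ω := by
    have : 0 < Fintype.card Ω := Fintype.card_pos_iff.2 ⟨w i⟩
    exact_mod_cast this
  have h2 : (0 : ℝ) < (fiber univ x (x (w i))).card := by exact_mod_cast card_fiber_univ_pos x (w i)
  exact (div_pos h1 h2).ne'

/-- Summing a function of one coordinate over all coin tuples: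
`Σ_{w ∈ Ωᵗ} g(w i) = |Ω|^{t-1} · Σ_{a ∈ Ω} g(a)`, written as `|Ω| · Σ_w g(w i) = |Ωᵗ| · Σ_a g a`.
[folklore] -/
theorem card_mul_sum_apply_eq {t : ℕ} (i : Fin t) (g : Ω → ℝ) :
    (Fintype.card Ω : ℝ) * ∑ w : Fin t → Ω, g (w i) =
      (Fintype.card (Fin t → Ω) : ℝ) * ∑ a : Ω, g a := by
  classical
  -- split `w ↦ (w i, w|_{j ≠ i})`
  have hsum : ∑ w : Fin t → Ω, g (w i) = ∑ p : Ω × ({j // j ≠ i} → Ω), g p.1 := by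
    refine Fintype.sum_equiv (Equiv.funSplitAt i Ω) _ _ fun w => ?_
    simp [Equiv.funSplitAt, Equiv.piSplitAt]
  rw [hsum, Fintype.sum_prod_type]
  simp only [Finset.sum_const, Finset.card_univ, nsmul_eq_mul]
  rw [← Finset.mul_sum, ← mul_assoc]
  congr 1
  have hcard : Fintype.card (Fin t → Ω) = Fintype.card Ω * Fintype.card ({j // j ≠ i} → Ω) := by
    rw [Fintype.card_congr (Equiv.funSplitAt i Ω), Fintype.card_prod]
  rw [hcard, Nat.cast_mul]

/-- **Shannon entropy is additive over independent repetitions**: `H(Xᵗ) = t · H(X)` for the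
source `X = x(U_Ω)` and its `t`-fold repetition `xᵗ(U_{Ωᵗ})`. [Cover–Thomas 2006, Thm. 2.6.6;
Haitner–Reingold–Vadhan 2013, proof of Lemma 2.1 ("the expectation (which is `t · H(X)`)")]
[cite: HaitnerReingoldVadhan2013, Lemma 2.1 (proof)] -/
theorem mapEntropy_tuple [Nonempty Ω] (x : Ω → U) (t : ℕ) :
    mapEntropy univ (fun v : Fin t → Ω => fun i => x (v i)) = t * mapEntropy univ x := by
  classical
  have hΩ : (0 : ℝ) < Fintype.card Ω := by exact_mod_cast Fintype.card_pos
  have hΩt : (0 : ℝ) < Fintype.card (Fin t → Ω) := by exact_mod_cast Fintype.card_pos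
  unfold mapEntropy
  rw [Finset.card_univ, Finset.card_univ]
  simp_rw [sampleEntropy_tuple x]
  rw [Finset.sum_comm]
  -- each coordinate contributes `|Ωᵗ| · H(X)`
  have hi : ∀ i : Fin t, ∑ w : Fin t → Ω, Real.logb 2 ((Fintype.card Ω : ℝ) / (fiber univ x (x (w i))).card) =
      (Fintype.card (Fin t → Ω) : ℝ) / Fintype.card Ω *
        ∑ a : Ω, Real.logb 2 ((Fintype.card Ω : ℝ) / (fiber univ x (x a)).card) := by
    intro i
    have h := card_mul_sum_apply_eq i (fun a => Real.logb 2 ((Fintype.card Ω : ℝ) / (fiber univ x (x a)).card))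
    field_simp
    linarith [h]
  rw [Finset.sum_congr rfl fun i _ => hi i, Finset.sum_const, Finset.card_univ, Fintype.card_fin,
    nsmul_eq_mul]
  field_simp

/-! ### Hoeffding tails for the sample entropy of `Xᵗ` -/

/-- **Upper tail** (sample entropy of `Xᵗ` rarely exceeds `t·H(X)` by much): for `t ≥ 1`, `η ≥ 0`
and `|Ω| ≥ 2`, the coin tuples `w ∈ Ωᵗ` with `Σᵢ H_X(x wᵢ) ≥ t·H(X) + tη·log₂|Ω|` number at most
`exp(−2tη²) · |Ω|ᵗ` — Hoeffding's inequality for the `[0,1]`-valued variables `H_X/log₂|Ω|`.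
[Haitner–Reingold–Vadhan 2013, Lemma 2.1 (1) and its proof; Hoeffding 1963, Thm. 2]
[cite: HaitnerReingoldVadhan2013, Lemma 2.1 (1)] -/
theorem card_sampleEntropy_tuple_ge_le_exp [Nonempty Ω] (x : Ω → U) {t : ℕ} (ht : 0 < t) {η : ℝ}
    (hη : 0 ≤ η) (hΩ : 1 < Fintype.card Ω) :
    ((univ.filter fun w : Fin t → Ω =>
        t * mapEntropy univ x + t * η * Real.logb 2 (Fintype.card Ω) ≤
          ∑ i, Real.logb 2 ((Fintype.card Ω : ℝ) / (fiber univ x (x (w i))).card)).card : ℝ) ≤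
      Real.exp (-2 * t * η ^ 2) * (Fintype.card Ω : ℝ) ^ t := by
  classical
  set L : ℝ := Real.logb 2 (Fintype.card Ω) with hL
  set Hs : Ω → ℝ := fun a => Real.logb 2 ((Fintype.card Ω : ℝ) / (fiber univ x (x a)).card) with hHs
  have hΩR : (1 : ℝ) < Fintype.card Ω := by exact_mod_cast hΩ
  have hΩ0 : (0 : ℝ) < Fintype.card Ω := by linarith
  have hL0 : 0 < L := Real.logb_pos (by norm_num) hΩR
  -- the normalised sample entropy is `[0,1]`-valued
  set F : Ω → ℝ := fun a => Hs a / L with hFdef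
  have hF : ∀ a, F a ∈ Set.Icc (0 : ℝ) 1 := fun a => by
    refine ⟨div_nonneg (logb_card_div_card_fiber_nonneg x (Finset.mem_univ a)) hL0.le, ?_⟩
    rw [div_le_one hL0, hL, ← Finset.card_univ]
    exact logb_card_div_card_fiber_le x (Finset.mem_univ a)
  have h := Complexity.card_upperDeviation_sum_le_exp F hF ht hη
  rw [Fintype.card_pi_const, Nat.cast_pow] at h
  refine le_trans ?_ h
  refine Nat.cast_le.2 (Finset.card_le_card fun w hw => ?_)
  rw [Finset.mem_filter] at hw ⊢
  refine ⟨Finset.mem_univ _, ?_⟩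
  -- `(Σ F)/|Ω| = H(X)/L` and `Σᵢ F(wᵢ) = (Σᵢ H_X(x wᵢ))/L`
  have havg : (∑ a, F a) / Fintype.card Ω = mapEntropy univ x / L := by
    simp only [hFdef, hHs, mapEntropy, Finset.card_univ]
    rw [← Finset.sum_div, div_right_comm]
  have hsumF : ∑ i, F (w i) = (∑ i, Hs (w i)) / L := by
    simp only [hFdef]
    rw [Finset.sum_div]
  rw [havg, hsumF]
  have hw2 : (t : ℝ) * mapEntropy univ x + t * η * L ≤ ∑ i, Hs (w i) := hw.2
  rw [show (∑ i, Hs (w i)) / L - (t : ℝ) * (mapEntropy univ x / L) =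
      ((∑ i, Hs (w i)) - t * mapEntropy univ x) / L by field_simp]
  rw [le_div_iff₀ hL0]
  linarith

/-- **Lower tail** (sample entropy of `Xᵗ` rarely falls much below `t·H(X)`): for `t ≥ 1`, `η ≥ 0`
and `|Ω| ≥ 2`, the coin tuples `w ∈ Ωᵗ` with `Σᵢ H_X(x wᵢ) ≤ t·H(X) − tη·log₂|Ω|` number at most
`exp(−2tη²) · |Ω|ᵗ` (Hoeffding applied to `1 − H_X/log₂|Ω|`).
[Haitner–Reingold–Vadhan 2013, Lemma 2.1 (1) and its proof; Hoeffding 1963, Thm. 2]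
[cite: HaitnerReingoldVadhan2013, Lemma 2.1 (1)] -/
theorem card_sampleEntropy_tuple_le_le_exp [Nonempty Ω] (x : Ω → U) {t : ℕ} (ht : 0 < t) {η : ℝ}
    (hη : 0 ≤ η) (hΩ : 1 < Fintype.card Ω) :
    ((univ.filter fun w : Fin t → Ω =>
        ∑ i, Real.logb 2 ((Fintype.card Ω : ℝ) / (fiber univ x (x (w i))).card) ≤
          t * mapEntropy univ x - t * η * Real.logb 2 (Fintype.card Ω)).card : ℝ) ≤
      Real.exp (-2 * t * η ^ 2) * (Fintype.card Ω : ℝ) ^ t := by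
  classical
  set L : ℝ := Real.logb 2 (Fintype.card Ω) with hL
  set Hs : Ω → ℝ := fun a => Real.logb 2 ((Fintype.card Ω : ℝ) / (fiber univ x (x a)).card) with hHs
  have hΩR : (1 : ℝ) < Fintype.card Ω := by exact_mod_cast hΩ
  have hΩ0 : (0 : ℝ) < Fintype.card Ω := by linarith
  have hL0 : 0 < L := Real.logb_pos (by norm_num) hΩR
  set F : Ω → ℝ := fun a => Hs a / L with hFdef
  have hF : ∀ a, F a ∈ Set.Icc (0 : ℝ) 1 := fun a => by
    refine ⟨div_nonneg (logb_card_div_card_fiber_nonneg x (Finset.mem_univ a)) hL0.le, ?_⟩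
    rw [div_le_one hL0, hL, ← Finset.card_univ]
    exact logb_card_div_card_fiber_le x (Finset.mem_univ a)
  have hF' : ∀ a, (1 - F a) ∈ Set.Icc (0 : ℝ) 1 := fun a =>
    ⟨sub_nonneg.2 (hF a).2, sub_le_self _ (hF a).1⟩
  have h := Complexity.card_upperDeviation_sum_le_exp (fun a => 1 - F a) hF' ht hη
  rw [Fintype.card_pi_const, Nat.cast_pow] at h
  refine le_trans ?_ h
  refine Nat.cast_le.2 (Finset.card_le_card fun w hw => ?_)
  rw [Finset.mem_filter] at hw ⊢
  refine ⟨Finset.mem_univ _, ?_⟩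
  have havg : (∑ a, F a) / Fintype.card Ω = mapEntropy univ x / L := by
    simp only [hFdef, hHs, mapEntropy, Finset.card_univ]
    rw [← Finset.sum_div, div_right_comm]
  have hsumF : ∑ i, F (w i) = (∑ i, Hs (w i)) / L := by
    simp only [hFdef]
    rw [Finset.sum_div]
  have hsum1 : ∑ i : Fin t, (1 - F (w i)) = t - ∑ i, F (w i) := by
    rw [Finset.sum_sub_distrib, Finset.sum_const, Finset.card_univ, Fintype.card_fin, nsmul_eq_mul,
      mul_one]
  have havg1 : (∑ a, (1 - F a)) / Fintype.card Ω = 1 - (∑ a, F a) / Fintype.card Ω := by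
    rw [Finset.sum_sub_distrib, Finset.sum_const, Finset.card_univ, nsmul_eq_mul, mul_one, sub_div,
      div_self hΩ0.ne']
  rw [hsum1, havg1, havg, hsumF]
  have hw2 : ∑ i, Hs (w i) ≤ (t : ℝ) * mapEntropy univ x - t * η * L := hw.2
  rw [show (t : ℝ) - (∑ i, Hs (w i)) / L - t * (1 - mapEntropy univ x / L) =
      (t * mapEntropy univ x - ∑ i, Hs (w i)) / L by field_simp; ring]
  rw [le_div_iff₀ hL0]
  linarith

/-- **Two-sided form**: the coin tuples whose sample entropy deviates from `t·H(X)` by at least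
`tη·log₂|Ω|` number at most `2 exp(−2tη²) · |Ω|ᵗ` ("with probability at least `1 − ε` over
`x ← Xᵗ`, `|H_{Xᵗ}(x) − t·H(X)| ≤ …`"). [Haitner–Reingold–Vadhan 2013, Lemma 2.1 (1)]
[cite: HaitnerReingoldVadhan2013, Lemma 2.1 (1)] -/
theorem card_sampleEntropy_tuple_dev_le_exp [Nonempty Ω] (x : Ω → U) {t : ℕ} (ht : 0 < t) {η : ℝ}
    (hη : 0 ≤ η) (hΩ : 1 < Fintype.card Ω) :
    ((univ.filter fun w : Fin t → Ω =>
        t * η * Real.logb 2 (Fintype.card Ω) ≤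
          |∑ i, Real.logb 2 ((Fintype.card Ω : ℝ) / (fiber univ x (x (w i))).card) -
            t * mapEntropy univ x|).card : ℝ) ≤
      2 * Real.exp (-2 * t * η ^ 2) * (Fintype.card Ω : ℝ) ^ t := by
  classical
  have h1 := card_sampleEntropy_tuple_ge_le_exp x ht hη hΩ
  have h2 := card_sampleEntropy_tuple_le_le_exp x ht hη hΩ
  set A := univ.filter fun w : Fin t → Ω =>
        t * mapEntropy univ x + t * η * Real.logb 2 (Fintype.card Ω) ≤
          ∑ i, Real.logb 2 ((Fintype.card Ω : ℝ) / (fiber univ x (x (w i))).card) with hA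
  set B := univ.filter fun w : Fin t → Ω =>
        ∑ i, Real.logb 2 ((Fintype.card Ω : ℝ) / (fiber univ x (x (w i))).card) ≤
          t * mapEntropy univ x - t * η * Real.logb 2 (Fintype.card Ω) with hB
  have hsub : (univ.filter fun w : Fin t → Ω =>
        t * η * Real.logb 2 (Fintype.card Ω) ≤
          |∑ i, Real.logb 2 ((Fintype.card Ω : ℝ) / (fiber univ x (x (w i))).card) -
            t * mapEntropy univ x|) ⊆ A ∪ B := by
    intro w hw
    rw [Finset.mem_union, hA, hB, Finset.mem_filter, Finset.mem_filter]
    have h := (Finset.mem_filter.1 hw).2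
    rcases le_abs'.1 h with h' | h'
    · exact Or.inr ⟨Finset.mem_univ _, by linarith⟩
    · exact Or.inl ⟨Finset.mem_univ _, by linarith⟩
  calc _ ≤ ((A ∪ B).card : ℝ) := by exact_mod_cast Finset.card_le_card hsub
    _ ≤ (A.card : ℝ) + B.card := by exact_mod_cast Finset.card_union_le A B
    _ ≤ Real.exp (-2 * t * η ^ 2) * (Fintype.card Ω : ℝ) ^ t +
          Real.exp (-2 * t * η ^ 2) * (Fintype.card Ω : ℝ) ^ t := add_le_add h1 h2
    _ = 2 * Real.exp (-2 * t * η ^ 2) * (Fintype.card Ω : ℝ) ^ t := by ring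

/-! ### Flattening: smooth min-entropy and smooth max-entropy of `Xᵗ` -/

/-- **Flattening to min-entropy** (heavy outcomes of `Xᵗ` are rare): for `t ≥ 1`, `η ≥ 0`,
`|Ω| ≥ 2`, the coin tuples `w ∈ Ωᵗ` whose outcome `xᵗ w` has probability
`≥ 2^{−(t·H(X) − tη·log₂|Ω|)}` — i.e. whose fibre has `≥ 2^{−(tH(X) − tη log₂|Ω|)} · |Ω|ᵗ` coin
tuples — number at most `exp(−2tη²) · |Ω|ᵗ`. Equivalently, `Xᵗ` is `exp(−2tη²)`-close to a
distribution of min-entropy `≥ t·H(X) − tη·log₂|Ω|` ("the Shannon entropy of a random variable can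
be converted to min-entropy (up to small statistical distance) by taking independent copies").
[Haitner–Reingold–Vadhan 2013, Lemma 2.1 (1); Håstad–Impagliazzo–Levin–Luby 1999, §4]
[cite: HaitnerReingoldVadhan2013, Lemma 2.1 (1)] -/
theorem card_heavy_tuple_le_exp [Nonempty Ω] (x : Ω → U) {t : ℕ} (ht : 0 < t) {η : ℝ}
    (hη : 0 ≤ η) (hΩ : 1 < Fintype.card Ω) :
    ((univ.filter fun w : Fin t → Ω =>
        (Fintype.card Ω : ℝ) ^ t *
            (2 : ℝ) ^ (-(t * mapEntropy univ x - t * η * Real.logb 2 (Fintype.card Ω))) ≤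
          ((fiber univ (fun v : Fin t → Ω => fun i => x (v i)) (fun i => x (w i))).card : ℝ)).card : ℝ) ≤
      Real.exp (-2 * t * η ^ 2) * (Fintype.card Ω : ℝ) ^ t := by
  classical
  refine le_trans ?_ (card_sampleEntropy_tuple_le_le_exp x ht hη hΩ)
  refine Nat.cast_le.2 (Finset.card_le_card fun w hw => ?_)
  rw [Finset.mem_filter] at hw ⊢
  refine ⟨Finset.mem_univ _, ?_⟩
  set k : ℝ := t * mapEntropy univ x - t * η * Real.logb 2 (Fintype.card Ω) with hk
  set Fw := fiber univ (fun v : Fin t → Ω => fun i => x (v i)) (fun i => x (w i)) with hFw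
  have hΩt : (0 : ℝ) < (Fintype.card Ω : ℝ) ^ t := by
    have : (0 : ℝ) < Fintype.card Ω := by exact_mod_cast Fintype.card_pos
    positivity
  have hFpos : (0 : ℝ) < Fw.card := by
    exact_mod_cast card_fiber_pos (fun v : Fin t → Ω => fun i => x (v i)) (Finset.mem_univ w)
  -- `Σᵢ H_X(x wᵢ) = log₂ (|Ω|ᵗ / |fibre|) ≤ k`
  rw [← sampleEntropy_tuple x w, Fintype.card_pi_const, Nat.cast_pow]
  rw [Real.logb_le_iff_le_rpow (by norm_num) (div_pos hΩt hFpos), div_le_iff₀ hFpos]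
  have hw2 : (Fintype.card Ω : ℝ) ^ t * (2 : ℝ) ^ (-k) ≤ Fw.card := hw.2
  calc (Fintype.card Ω : ℝ) ^ t = (Fintype.card Ω : ℝ) ^ t * (2 : ℝ) ^ (-k) * (2 : ℝ) ^ k := by
        rw [mul_assoc, ← Real.rpow_add (by norm_num), neg_add_cancel, Real.rpow_zero, mul_one]
    _ ≤ Fw.card * (2 : ℝ) ^ k := mul_le_mul_of_nonneg_right hw2 (by positivity)
    _ = (2 : ℝ) ^ k * Fw.card := mul_comm _ _

/-- **Flattening to max-entropy** (the light outcomes of `Xᵗ` are few): for every threshold `k`,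
the outcomes `xᵗ w` of sample entropy `Σᵢ H_X(x wᵢ) < k` — i.e. of probability `> 2^{-k}` — are at
most `2ᵏ` in number (their fibres are disjoint and each has more than `2^{-k} |Ω|ᵗ` coin tuples).
With `k = t·H(X) + tη·log₂|Ω|` the remaining coin tuples number at most `exp(−2tη²) · |Ω|ᵗ`
(`card_sampleEntropy_tuple_ge_le_exp`), so `Xᵗ` is `exp(−2tη²)`-close to a distribution supported
on at most `2^{tH(X) + tη log₂|Ω|}` values. [Haitner–Reingold–Vadhan 2013, Lemma 2.1 (1);
Håstad–Impagliazzo–Levin–Luby 1999, §4] [cite: HaitnerReingoldVadhan2013, Lemma 2.1 (1)] -/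
theorem card_image_light_tuple_le [Nonempty Ω] (x : Ω → U) (t : ℕ) (k : ℝ) :
    ((((univ : Finset (Fin t → Ω)).filter fun w =>
        ∑ i, Real.logb 2 ((Fintype.card Ω : ℝ) / (fiber univ x (x (w i))).card) < k).image
          (fun w : Fin t → Ω => fun i => x (w i))).card : ℝ) ≤ (2 : ℝ) ^ k := by
  classical
  set T : (Fin t → Ω) → (Fin t → U) := fun w i => x (w i) with hT
  set Lt := (univ : Finset (Fin t → Ω)).filter fun w =>
        ∑ i, Real.logb 2 ((Fintype.card Ω : ℝ) / (fiber univ x (x (w i))).card) < k with hLt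
  set V := Lt.image T with hV
  have hΩt : (0 : ℝ) < (Fintype.card Ω : ℝ) ^ t := by
    have : (0 : ℝ) < Fintype.card Ω := by exact_mod_cast Fintype.card_pos
    positivity
  -- every value in `V` has a fibre of more than `2^{-k} |Ω|ᵗ` coin tuples
  have hbig : ∀ v ∈ V, (Fintype.card Ω : ℝ) ^ t * (2 : ℝ) ^ (-k) ≤ ((fiber univ T v).card : ℝ) := by
    intro v hv
    obtain ⟨w, hw, rfl⟩ := Finset.mem_image.1 hv
    have hwk := (Finset.mem_filter.1 hw).2
    rw [← sampleEntropy_tuple x w, Fintype.card_pi_const, Nat.cast_pow] at hwk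
    have hFpos : (0 : ℝ) < (fiber univ T (T w)).card := by
      exact_mod_cast card_fiber_pos T (Finset.mem_univ w)
    have hwk' : (Fintype.card Ω : ℝ) ^ t / (fiber univ T (T w)).card < (2 : ℝ) ^ k :=
      (Real.logb_lt_iff_lt_rpow (by norm_num) (div_pos hΩt hFpos)).1 hwk
    rw [div_lt_iff₀ hFpos] at hwk'
    calc (Fintype.card Ω : ℝ) ^ t * (2 : ℝ) ^ (-k)
        ≤ (2 : ℝ) ^ k * (fiber univ T (T w)).card * (2 : ℝ) ^ (-k) :=
          mul_le_mul_of_nonneg_right hwk'.le (by positivity)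
      _ = (fiber univ T (T w)).card := by
          rw [mul_comm ((2 : ℝ) ^ k), mul_assoc, ← Real.rpow_add (by norm_num), add_neg_cancel,
            Real.rpow_zero, mul_one]
  -- the fibres over `V` are disjoint pieces of `Ωᵗ`
  have hsum : ∑ v ∈ V, ((fiber univ T v).card : ℝ) ≤ (Fintype.card Ω : ℝ) ^ t := by
    have h := Finset.sum_card_fiberwise_eq_card_filter (univ : Finset (Fin t → Ω)) V T
    have h' : ∑ v ∈ V, (fiber univ T v).card ≤ Fintype.card (Fin t → Ω) := by
      unfold fiber
      rw [h, ← Finset.card_univ]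
      exact Finset.card_le_card (Finset.filter_subset _ _)
    rw [Fintype.card_pi_const] at h'
    exact_mod_cast h'
  have hV : (V.card : ℝ) * ((Fintype.card Ω : ℝ) ^ t * (2 : ℝ) ^ (-k)) ≤ (Fintype.card Ω : ℝ) ^ t := by
    have h := Finset.card_nsmul_le_sum V (fun v => ((fiber univ T v).card : ℝ)) _ hbig
    rw [nsmul_eq_mul] at h
    exact h.trans hsum
  -- divide by `|Ω|ᵗ 2^{-k}`
  have h2k : (0 : ℝ) < (2 : ℝ) ^ (-k) := by positivity
  have hV' : (V.card : ℝ) * (2 : ℝ) ^ (-k) ≤ 1 := by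
    have : (V.card : ℝ) * (2 : ℝ) ^ (-k) * (Fintype.card Ω : ℝ) ^ t ≤ 1 * (Fintype.card Ω : ℝ) ^ t := by
      rw [one_mul]; calc _ = (V.card : ℝ) * ((Fintype.card Ω : ℝ) ^ t * (2 : ℝ) ^ (-k)) := by ring
        _ ≤ _ := hV
    exact le_of_mul_le_mul_right this hΩt
  calc (V.card : ℝ) = (V.card : ℝ) * (2 : ℝ) ^ (-k) * (2 : ℝ) ^ k := by
        rw [mul_assoc, ← Real.rpow_add (by norm_num), neg_add_cancel, Real.rpow_zero, mul_one]
    _ ≤ 1 * (2 : ℝ) ^ k := mul_le_mul_of_nonneg_right hV' (by positivity)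
    _ = (2 : ℝ) ^ k := one_mul _

end Flattening

end Literature.Computability.Cryptography
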